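import Summits.QuantumFields.YangMills.Theorems.UnitScaleTiltProp7FlatResidualAlgebra
import Summits.QuantumFields.YangMills.Theorems.UnitScaleTiltProp7BlockPoincareKerQprime
import Literature.MathematicalPhysics.QuantumFieldTheory.Balaban1983to89.B9Eq326OperatorTowerFlat
import Literature.MathematicalPhysics.QuantumFieldTheory.Balaban1983to89.B9Eq316TowerFlatIsOneStep
import HarnessLib

/-!
# Route `UnitScaleTilt`, crux K1 «MinimiserStabilityRegPr» (stmt-QuantumFields-19200), stub `stub_existenceMinimalOrbit` (EX) — N06 print row `h349`, FLAT-CERTIFICATE ROAD,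
# FILE 3b∕4 «THE ROUTE's GAUGE PROJECTOR `R_S(1)` IS THE NE9 TOWER's `R_k(1)`»: along the member's period identity ✓`Prop7BlockPoincareKerQprime.periodsT3_eq_towerP`
# (`periodsT3 F K = towerP L (N_{K−n}) (K−n−1+1)`), the `L²` site cast carries `Prop7SectET3GaugeProjector.RS F n K _ c₀ cB 1` (the orthogonal projection onto
# `Δ^η_1 N_S(1)`, `N_S = ker(Q(1)∘D_1)`) onto `B9Eq326OperatorTower.RofUk L (N_{K−n}) (K−n−1) frobEquiv η 1` (the orthogonal projection onto `Δ^η_1 N(Q′_k(1))`):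
# **`Φ (R_S(1) l) = R_k(1) (Φ l)`** — the one new dictionary lemma of memo `LOCATE-H349-FLATCERT-TOWER-px20g6.md` §4 F3 (ii)

Cell `ym3-torus`, width seat `ym3-torus-px20` (gen 6); pen «FLAT-CERT `h349(1)`» (★★OWNER g30 WORD 5 ∕ ★w2-19200 g8 08:25:14Z GO, certificate class).  THEOREMS ONLY (0 `def`, 0 `sorry`);
`--supports stmt-QuantumFields-19200 --as helper`, count-neutral.  YM₃ on T³ is a ladder rung (R3), not the Clay problem; nothing here claims `h349`, N06, the stub, the crux or
the mass gap.

HOW.  Both projectors are `B11Eq103H1Complex.RLatticeK η⁻¹ R S Q′ = projR (Δ[R,S]) Q′`, an orthogonal projection onto `(ker Q′).map Δ`; along the cast ✓`B9Eq316TowerFlatIsOneStep.RLatticeK_siteL2Cast`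
transports `R_S(1)` to `RLatticeK η⁻¹ (Ad 1) (Ad 1) (Q(1)D_1 ∘ Φ⁻¹)`; at `U = 1` all transporter families are the identity, so both Laplacians are the flat `Δ^η_1`; and the two
RANGES agree: `Δ^η_1·Φ(N_S(1)) = Δ^η_1·N(Q′_k(1))` — `N(Q′_k(1))` = zero `(K−n)`-block means (§1: ✓`QprimeTowerW_one_apply` + ✓`QprimeTower_flat_apply` read through the value-preserving
charts onto ✓`B5Eq118OneStroke.iterBlock`), `N_S(1)` = constant block sums (FILE 3a ✓`Prop7FlatResidualAlgebra.toL2S_mem_NS_one_iff`), and constants are `Δ^η_1`-invisible.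

WHAT IS PROVED (ns `Summit.QuantumFields.YangMills.Theorems.Prop7FlatGaugeProjectorTower`; member `F n K`, `hnK : n < K`, weights `c₀ cB`).
* §1 `QprimeTowerW_one_cast_apply` (the flat tower site averaging of `Φ(toL2S λ)` at the coarse site `y` is `(L^{K−n})^{−3}` times the `(K−n)`-block sum of `λ` over the block with
  labels `y`), `QprimeTowerW_one_cast_eq_zero_iff` (`Q′_k(1)(Φ(toL2S λ)) = 0 ↔` all block sums of `λ` vanish).
* §2 `adBg_one_eq`, `adBgInv_one_eq`, `adTransportW_one_eq`, `adTransportW_inv_one_eq` (all four transporter families at `1` are `fun _ ↦ id`), `map_ker_eq` (the range identity).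
* §3 ★★★ `siteL2Cast_RS_one` — `siteL2Cast ℂ hP (RS F n K _ c₀ cB 1 l) = RofUk F.L (fun _ ↦ N_{K−n}) (K−n−1) frobEquiv (eta F n K) 1 (siteL2Cast ℂ hP l)`, `hP := periodsT3_eq_towerP F n K hnK`.
HONEST SCOPE.  Flat member only; linear algebra + index bookkeeping over landed letters; no estimate.  Rung R3, not Clay; YM gap NOT proved.

References: T. Bałaban, CMP **99** (1985) 389–434 [Balaban1985BackgroundPropagators] ((3.19)–(3.23) pp.393–394, (3.115) p.418); CMP **96** (1984) 223–250 [Balaban1984PropagatorsII]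
((2.10)–(2.12) p.225); CMP **95** (1984) 17–40 [Balaban1984PropagatorsI] ((1.18) p.20).
-/

set_option autoImplicit false

noncomputable section

open scoped InnerProductSpace ComplexConjugate Matrix.Norms.L2Operator BigOperators

namespace Summit.QuantumFields.YangMills.Theorems.Prop7FlatGaugeProjectorTower

open Literature.MathematicalPhysics.QuantumFieldTheory.Balaban1983to89
open Literature.MathematicalPhysics.QuantumFieldTheory.Balaban1983to89.T3ContinuumYM3Torus
open T3SectALandauChart (eta eta_pos)
open B4Sect5Torus (TSite)
open B9SectCLatticeCarrier (Bond)
open B9Eq311L2Pairing (WL2)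
open B5Eq118OneStroke (iterBlock mem_iterBlock_iff)
open B11Eq103H1Complex (SiteL2K BondL2K projR covLaplaceSiteK RLatticeK)
open B9Eq310HessianOperator (adTransportW adTransportW_apply)
open B9Eq315QTower (towerP QprimeTower)
open B9Eq316TowerFlatIsOneStep (siteCast siteCast_apply_val siteL2Cast equiv_siteL2Cast RLatticeK_siteL2Cast bondCast QprimeTower_flat_apply)
open B9Eq326OperatorTower (QprimeTowerW RofUk)
open B9Eq326OperatorTowerFlat (QprimeTowerW_one_apply)
open Summit.QuantumFields.YangMills.Theorems.Prop7SectET3Transport (periodsT3 siteEquiv siteEquiv_symm_apply bgOfCfg)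
open Summit.QuantumFields.YangMills.Theorems.Prop7SectET3HilbertLetters (W₂ frobEquiv toL2S toL2S_apply adBg adBgInv adBg_one covLapSite covLapSite_eq)
open Summit.QuantumFields.YangMills.Theorems.Prop7SectET3GaugeProjector (QDS NS RS mem_NS_iff)
open Summit.QuantumFields.YangMills.Theorems.Prop7BlockPoincareKerQprime (periodsT3_eq_towerP)
open Summit.QuantumFields.YangMills.Theorems.Prop7BernPFlatMember (toL2S_mem_NS_one_of_blockSum_eq_zero)
open Summit.QuantumFields.YangMills.Theorems.Prop7FlatResidualAlgebra (toL2S_mem_NS_one_iff covLapSite_one_toL2S_const)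

variable (F : T3Family) [NeZero F.L] (n K : ℕ) (hnK : n < K) (c₀ cB : ℝ) [Fact (0 < c₀)] [Fact (0 < cB)]

/-! ## §1 The block dictionary: the flat tower site averaging of a cast gauge parameter is the `(K−n)`-block sum -/

omit [NeZero F.L] [Fact (0 < cB)] [Fact (0 < c₀)] in
/-- `((ZMod.finEquiv N)⁻¹ z).val = z.val`. [folklore] -/
private theorem val_finEquiv_symm {N : ℕ} [NeZero N] (z : ZMod N) : (((ZMod.finEquiv N).symm z : Fin N) : ℕ) = z.val := by
  cases N with
  | zero => exact absurd rfl (NeZero.ne 0)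
  | succ N => rfl

omit [Fact (0 < cB)] [Fact (0 < c₀)] in
/-- **THE FLAT TOWER SITE AVERAGING OF `Φ(toL2S λ)` IS THE BIG BLOCK MEAN OF `λ`**: at the coarse site `y`,
`(Q′_k(1)(Φ(toL2S λ)))(y) = ((L^{K−n−1+1})³)⁻¹ • frobEquiv⁻¹(Σ_{x ∈ B^{K−n}(ŷ)} λ x)`, `ŷ_μ := y_μ mod N_{K−n}` (✓`QprimeTowerW_one_apply`, ✓`QprimeTower_flat_apply`, the
value-preserving charts, ✓`mem_iterBlock_iff`). [cite: Balaban1984PropagatorsI, (1.18) p.20; Balaban1985BackgroundPropagators, (3.19) p.393] -/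
theorem QprimeTowerW_one_cast_apply (lam : Site (F.P K) 0 → Matrix (Fin 2) (Fin 2) ℂ) (y : TSite 3 (fun _ : Fin 3 => (F.P K).sitesPerDir (K - n))) :
    haveI : ∀ i : Fin 3, NeZero ((fun _ : Fin 3 => (F.P K).sitesPerDir (K - n)) i) := fun _ => inferInstance
    QprimeTowerW F.L (fun _ : Fin 3 => (F.P K).sitesPerDir (K - n)) (K - n - 1) frobEquiv
        (fun _ : Bond 3 (towerP F.L (fun _ : Fin 3 => (F.P K).sitesPerDir (K - n)) (K - n - 1 + 1)) => (1 : (Matrix (Fin 2) (Fin 2) ℂ)ˣ)) (c₀ := c₀)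
        (siteL2Cast ℂ (periodsT3_eq_towerP F n K hnK) (toL2S F K c₀ lam)) y =
      ((((F.L : ℝ) ^ (K - n - 1 + 1)) ^ 3)⁻¹) • frobEquiv.symm (∑ x ∈ iterBlock (K - n) (fun μ => (((y μ : ℕ) : ZMod ((F.P K).sitesPerDir (K - n))))), lam x) := by
  classical
  have hk : K - n ≤ (F.P K).m + (F.P K).K := by
    show K - n ≤ F.m + K
    exact le_trans (Nat.sub_le K n) (Nat.le_add_left K F.m)
  have hKn : K - n - 1 + 1 = K - n := Nat.sub_add_cancel (Nat.le_sub_of_add_le' hnK)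
  rw [QprimeTowerW_one_apply, QprimeTower_flat_apply, equiv_siteL2Cast]
  -- reindex the fine sum by the chart `e := siteCast hP ∘ siteEquiv F K`
  rw [map_sum, Finset.smul_sum]
  symm
  refine Finset.sum_equiv ((siteEquiv F K).trans (siteCast (periodsT3_eq_towerP F n K hnK))) (fun x => ?_) (fun x hx => ?_)
  · -- membership: `x ∈ B^{K−n}(ŷ)` iff every label of `e x` integer-divides to `y`
    rw [mem_iterBlock_iff hk, Finset.mem_filter]
    simp only [Finset.mem_univ, true_and, Equiv.trans_apply, siteCast_apply_val, hKn]
    constructor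
    · intro hx i
      have h : (x i).val / F.L ^ (K - n) = ((((y i : ℕ)) : ZMod ((F.P K).sitesPerDir (K - n)))).val := hx i
      rw [Prop7SectET3Transport.siteEquiv_apply, val_finEquiv_symm, h, ZMod.val_natCast, Nat.mod_eq_of_lt (y i).isLt]
    · intro hx μ
      have h := hx μ
      rw [Prop7SectET3Transport.siteEquiv_apply, val_finEquiv_symm] at h
      show (x μ).val / F.L ^ (K - n) = ((((y μ : ℕ)) : ZMod ((F.P K).sitesPerDir (K - n)))).val
      rw [h, ZMod.val_natCast, Nat.mod_eq_of_lt (y μ).isLt]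
  · -- the summand
    simp only [Function.comp_apply, Equiv.trans_apply, Equiv.symm_apply_apply, toL2S_apply]

omit [Fact (0 < cB)] [Fact (0 < c₀)] in
/-- **`Q′_k(1)(Φ(toL2S λ)) = 0` ↔ every `(K−n)`-block sum of `λ` vanishes.** [cite: Balaban1985BackgroundPropagators, (3.19)–(3.21) pp.393–394] -/
theorem QprimeTowerW_one_cast_eq_zero_iff (lam : Site (F.P K) 0 → Matrix (Fin 2) (Fin 2) ℂ) :
    haveI : ∀ i : Fin 3, NeZero ((fun _ : Fin 3 => (F.P K).sitesPerDir (K - n)) i) := fun _ => inferInstance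
    QprimeTowerW F.L (fun _ : Fin 3 => (F.P K).sitesPerDir (K - n)) (K - n - 1) frobEquiv
        (fun _ : Bond 3 (towerP F.L (fun _ : Fin 3 => (F.P K).sitesPerDir (K - n)) (K - n - 1 + 1)) => (1 : (Matrix (Fin 2) (Fin 2) ℂ)ˣ)) (c₀ := c₀)
        (siteL2Cast ℂ (periodsT3_eq_towerP F n K hnK) (toL2S F K c₀ lam)) = 0 ↔
      ∀ y : Site (F.P K) (K - n), ∑ x ∈ iterBlock (K - n) y, lam x = 0 := by
  have hL : ((((F.L : ℝ) ^ (K - n - 1 + 1)) ^ 3)⁻¹) ≠ 0 := inv_ne_zero (pow_ne_zero _ (pow_ne_zero _ (by have := F.hL.2; exact_mod_cast (show F.L ≠ 0 by omega))))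
  constructor
  · intro h y
    -- read `h` at the coarse label vector of `y`
    obtain ⟨yF, hyF⟩ : ∃ yF : TSite 3 (fun _ : Fin 3 => (F.P K).sitesPerDir (K - n)), yF = fun i => (⟨(y i).val, ZMod.val_lt (y i)⟩ : Fin ((F.P K).sitesPerDir (K - n))) :=
      ⟨_, rfl⟩
    have hy := congr_fun h yF
    rw [QprimeTowerW_one_cast_apply F n K hnK c₀, Pi.zero_apply, smul_eq_zero, or_iff_right hL, LinearEquiv.map_eq_zero_iff] at hy
    have hyy : (fun μ : Fin (F.P K).d => (((yF μ : ℕ)) : ZMod ((F.P K).sitesPerDir (K - n)))) = y := by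
      funext μ; simp only [hyF]; exact ZMod.natCast_zmod_val (y μ)
    simpa only [hyy] using hy
  · intro h
    funext y
    rw [QprimeTowerW_one_cast_apply F n K hnK c₀, h, map_zero, smul_zero, Pi.zero_apply]

/-! ## §2 The transporter families at `1`, and the range identity -/

omit [NeZero F.L] [Fact (0 < cB)] [Fact (0 < c₀)] in
/-- `adBg F K 1 = fun _ ↦ id`. [cite: Balaban1985BackgroundPropagators, (3.3) p.391] -/
theorem adBg_one_eq : adBg F K (1 : GaugeField (F.P K) 0 (Matrix.specialUnitaryGroup (Fin 2) ℂ)) = fun _ => LinearMap.id := funext fun b => (adBg_one b).1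

omit [NeZero F.L] [Fact (0 < cB)] [Fact (0 < c₀)] in
/-- `adBgInv F K 1 = fun _ ↦ id`. [cite: Balaban1985BackgroundPropagators, (3.8) p.392] -/
theorem adBgInv_one_eq : adBgInv F K (1 : GaugeField (F.P K) 0 (Matrix.specialUnitaryGroup (Fin 2) ℂ)) = fun _ => LinearMap.id := funext fun b => (adBg_one b).2

omit [NeZero F.L] [Fact (0 < cB)] [Fact (0 < c₀)] in
/-- `adTransportW frobEquiv (fun _ ↦ 1) = fun _ ↦ id` on any bond carrier. [cite: Balaban1985BackgroundPropagators, (3.3) p.391] -/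
theorem adTransportW_one_eq {P : Fin 3 → ℕ} : adTransportW frobEquiv (fun _ : Bond 3 P => (1 : (Matrix (Fin 2) (Fin 2) ℂ)ˣ)) = fun _ => LinearMap.id := by
  funext b; apply LinearMap.ext; intro w
  rw [adTransportW_apply, Units.val_one, inv_one, Units.val_one, one_mul, mul_one, LinearEquiv.symm_apply_apply, LinearMap.id_apply]

omit [NeZero F.L] [Fact (0 < cB)] [Fact (0 < c₀)] in
/-- `adTransportW frobEquiv (fun b ↦ (1 b)⁻¹) = fun _ ↦ id`. [cite: Balaban1985BackgroundPropagators, (3.8) p.392] -/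
theorem adTransportW_inv_one_eq {P : Fin 3 → ℕ} :
    adTransportW frobEquiv (fun b : Bond 3 P => ((fun _ : Bond 3 P => (1 : (Matrix (Fin 2) (Fin 2) ℂ)ˣ)) b)⁻¹) = fun _ => LinearMap.id := by
  funext b; apply LinearMap.ext; intro w
  rw [adTransportW_apply, inv_one, Units.val_one, inv_one, Units.val_one, one_mul, mul_one, LinearEquiv.symm_apply_apply, LinearMap.id_apply]

/-- Orthogonal projections onto equal ranges coincide: `(ker Q₁).map Δ = (ker Q₂).map Δ ⟹ projR Δ Q₁ = projR Δ Q₂`. [folklore] -/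
private theorem projR_congr {E F₁ F₂ : Type*} [NormedAddCommGroup E] [InnerProductSpace ℂ E] [FiniteDimensional ℂ E] [AddCommGroup F₁] [Module ℂ F₁] [AddCommGroup F₂] [Module ℂ F₂]
    (Δs : E →ₗ[ℂ] E) (Q₁ : E →ₗ[ℂ] F₁) (Q₂ : E →ₗ[ℂ] F₂) (hK : (LinearMap.ker Q₁).map Δs = (LinearMap.ker Q₂).map Δs) : projR Δs Q₁ = projR Δs Q₂ := by
  unfold projR
  simp only [hK]

/-- **THE RANGE IDENTITY `Δ^η_1·Φ(N_S(1)) = Δ^η_1·N(Q′_k(1))`** on the tower carrier: the kernel of `Q(1)D_1 ∘ Φ⁻¹` (constant block sums, FILE 3a) and the kernel of `Q′_k(1)` (zero block means, §1)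
differ by the constants, which `Δ^η_1` kills. [cite: Balaban1985BackgroundPropagators, (3.21) p.394, (3.115) p.418; Balaban1984PropagatorsII, (2.10)–(2.12) p.225] -/
theorem map_ker_eq :
    haveI : ∀ i : Fin 3, NeZero ((fun _ : Fin 3 => (F.P K).sitesPerDir (K - n)) i) := fun _ => inferInstance
    (LinearMap.ker (QDS F n K hnK.le c₀ cB (1 : GaugeField (F.P K) 0 (Matrix.specialUnitaryGroup (Fin 2) ℂ)) ∘ₗ
        (siteL2Cast ℂ (periodsT3_eq_towerP F n K hnK)).symm.toLinearMap)).map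
        (covLaplaceSiteK (((eta F n K : ℝ) : ℂ)⁻¹) (fun _ : Bond 3 _ => (LinearMap.id : W₂ →ₗ[ℂ] W₂)) (fun _ => LinearMap.id)) =
      (LinearMap.ker (QprimeTowerW F.L (fun _ : Fin 3 => (F.P K).sitesPerDir (K - n)) (K - n - 1) frobEquiv
        (fun _ : Bond 3 (towerP F.L (fun _ : Fin 3 => (F.P K).sitesPerDir (K - n)) (K - n - 1 + 1)) => (1 : (Matrix (Fin 2) (Fin 2) ℂ)ˣ)) (c₀ := c₀))).map
        (covLaplaceSiteK (((eta F n K : ℝ) : ℂ)⁻¹) (fun _ : Bond 3 _ => (LinearMap.id : W₂ →ₗ[ℂ] W₂)) (fun _ => LinearMap.id)) := by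
  classical
  haveI : ∀ i : Fin 3, NeZero ((fun _ : Fin 3 => (F.P K).sitesPerDir (K - n)) i) := fun _ => inferInstance
  set hP := periodsT3_eq_towerP F n K hnK with hhP
  set Φ := siteL2Cast ℂ (c₀ := c₀) (W := W₂) hP with hΦ
  have hk : K - n ≤ (F.P K).m + (F.P K).K := by
    show K - n ≤ F.m + K
    exact le_trans (Nat.sub_le K n) (Nat.le_add_left K F.m)
  -- the flat site Laplacian on the tower carrier is the cast of the route's `Δ^η_1`
  have hΔ : ∀ l : SiteL2K ℂ 3 (periodsT3 F K) c₀ W₂,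
      covLaplaceSiteK (((eta F n K : ℝ) : ℂ)⁻¹) (fun _ : Bond 3 _ => (LinearMap.id : W₂ →ₗ[ℂ] W₂)) (fun _ => LinearMap.id) (Φ l) = Φ (covLapSite F n K c₀ 1 l) := by
    intro l
    have h1 := B9Eq316TowerFlatIsOneStep.covLaplaceSiteK_one_siteL2Cast (𝔸 := Matrix (Fin 2) (Fin 2) ℂ) frobEquiv (c₀ := c₀) hP (((eta F n K : ℝ) : ℂ)⁻¹) l
    rw [adTransportW_one_eq, adTransportW_inv_one_eq, adTransportW_one_eq, adTransportW_inv_one_eq] at h1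
    rw [hΦ, h1, covLapSite_eq, adBg_one_eq, adBgInv_one_eq]
  -- every element of the tower carrier is `Φ(toL2S λ)`
  have hsurj : ∀ l : SiteL2K ℂ 3 (towerP F.L (fun _ : Fin 3 => (F.P K).sitesPerDir (K - n)) (K - n - 1 + 1)) c₀ W₂,
      ∃ lam : Site (F.P K) 0 → Matrix (Fin 2) (Fin 2) ℂ, l = Φ (toL2S F K c₀ lam) := fun l =>
    ⟨(toL2S F K c₀).symm (Φ.symm l), by rw [LinearEquiv.apply_symm_apply, LinearEquiv.apply_symm_apply]⟩
  apply le_antisymm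
  · -- `⊆`: constant block sums; subtract the constant
    intro v hv
    obtain ⟨l, hl, rfl⟩ := Submodule.mem_map.1 hv
    obtain ⟨lam, rfl⟩ := hsurj l
    rw [LinearMap.mem_ker, LinearMap.comp_apply, LinearEquiv.coe_toLinearMap, LinearEquiv.symm_apply_apply] at hl
    have hNS : toL2S F K c₀ lam ∈ NS F n K hnK.le c₀ cB 1 := (mem_NS_iff _ _).2 hl
    obtain ⟨C, hC⟩ := (toL2S_mem_NS_one_iff F n K hnK.le c₀ cB lam).1 hNS
    -- the constant and the zero-block-sum remainder
    set N : ℕ := ((F.P K).L ^ (F.P K).d) ^ (K - n) with hN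
    have hN0 : (N : ℂ) ≠ 0 := by rw [hN]; exact_mod_cast pow_ne_zero _ (pow_ne_zero _ (F.P K).L_pos.ne')
    set Z : Matrix (Fin 2) (Fin 2) ℂ := ((N : ℂ)⁻¹) • C with hZ
    have hsplit : toL2S F K c₀ lam = toL2S F K c₀ (fun x => lam x - Z) + toL2S F K c₀ (fun _ => Z) := by
      rw [← map_add]; congr 1; funext x; simp
    have hzero : ∀ y : Site (F.P K) (K - n), ∑ x ∈ iterBlock (K - n) y, (fun x => lam x - Z) x = 0 := by
      intro y
      rw [Finset.sum_sub_distrib, hC y, Finset.sum_const, B5Eq118OneStroke.card_iterBlock (K - n) hk, ← hN, hZ, ← Nat.cast_smul_eq_nsmul ℂ, smul_smul,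
        mul_inv_cancel₀ hN0, one_smul, sub_self]
    refine Submodule.mem_map.2 ⟨Φ (toL2S F K c₀ (fun x => lam x - Z)), ?_, ?_⟩
    · rw [LinearMap.mem_ker]
      exact (QprimeTowerW_one_cast_eq_zero_iff F n K hnK c₀ _).2 hzero
    · rw [hΔ, hΔ, hsplit, map_add, covLapSite_one_toL2S_const, add_zero]
  · -- `⊇`: zero block sums are residual
    intro v hv
    obtain ⟨l, hl, rfl⟩ := Submodule.mem_map.1 hv
    obtain ⟨lam, rfl⟩ := hsurj l
    rw [LinearMap.mem_ker] at hl
    have hzero := (QprimeTowerW_one_cast_eq_zero_iff F n K hnK c₀ lam).1 hl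
    refine Submodule.mem_map.2 ⟨Φ (toL2S F K c₀ lam), ?_, rfl⟩
    rw [LinearMap.mem_ker, LinearMap.comp_apply, LinearEquiv.coe_toLinearMap, LinearEquiv.symm_apply_apply]
    exact (mem_NS_iff _ _).1 (toL2S_mem_NS_one_of_blockSum_eq_zero (h := hnK.le) (cB := cB) lam hzero)

/-! ## §3 The projector identity -/

/-- ★★★ **THE ROUTE's `R_S(1)` IS THE TOWER's `R_k(1)` ALONG THE PERIOD CAST**: for every gauge parameter `l` of the member,
`Φ (R_S(1) l) = R_k(1) (Φ l)`, `Φ := siteL2Cast ℂ (periodsT3_eq_towerP F n K hnK)` — both are `projR` onto `Δ^η_1 N` with the ranges identified by `map_ker_eq`.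
[cite: Balaban1985BackgroundPropagators, (3.21)–(3.23) p.394, (3.115) p.418; Balaban1984PropagatorsII, (2.10)–(2.12) p.225] -/
theorem siteL2Cast_RS_one (l : SiteL2K ℂ 3 (periodsT3 F K) c₀ W₂) :
    haveI : ∀ i : Fin 3, NeZero ((fun _ : Fin 3 => (F.P K).sitesPerDir (K - n)) i) := fun _ => inferInstance
    siteL2Cast ℂ (periodsT3_eq_towerP F n K hnK) (RS F n K hnK.le c₀ cB (1 : GaugeField (F.P K) 0 (Matrix.specialUnitaryGroup (Fin 2) ℂ)) l) =
      RofUk F.L (fun _ : Fin 3 => (F.P K).sitesPerDir (K - n)) (K - n - 1) frobEquiv (eta F n K)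
        (fun _ : Bond 3 (towerP F.L (fun _ : Fin 3 => (F.P K).sitesPerDir (K - n)) (K - n - 1 + 1)) => (1 : (Matrix (Fin 2) (Fin 2) ℂ)ˣ)) (c₀ := c₀)
        (siteL2Cast ℂ (periodsT3_eq_towerP F n K hnK) l) := by
  haveI : ∀ i : Fin 3, NeZero ((fun _ : Fin 3 => (F.P K).sitesPerDir (K - n)) i) := fun _ => inferInstance
  set hP := periodsT3_eq_towerP F n K hnK with hhP
  -- transport `R_S(1)` across the cast: an `RLatticeK` with transported data
  have hsymm : (siteL2Cast ℂ (c₀ := c₀) (W := W₂) hP.symm) = (siteL2Cast ℂ (c₀ := c₀) (W := W₂) hP).symm := by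
    have : ∀ {P P' : Fin 3 → ℕ} (h : P = P'), (siteL2Cast ℂ (c₀ := c₀) (W := W₂) h.symm) = (siteL2Cast ℂ (c₀ := c₀) (W := W₂) h).symm := by
      intro P P' h; subst h; rfl
    exact this hP
  have hT := RLatticeK_siteL2Cast ℂ (c₀ := c₀) (W := W₂) hP.symm (((eta F n K : ℝ) : ℂ)⁻¹) (adBg F K 1) (adBgInv F K 1) (QDS F n K hnK.le c₀ cB 1)
  -- read `hT` at `Φ l`
  have hTl := congrArg (fun T => T (siteL2Cast ℂ hP l)) hT
  simp only [LinearMap.comp_apply, LinearEquiv.coe_toLinearMap, hsymm, LinearEquiv.symm_symm, LinearEquiv.symm_apply_apply] at hTl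
  -- `RS = RLatticeK …` by definition
  rw [show RS F n K hnK.le c₀ cB (1 : GaugeField (F.P K) 0 (Matrix.specialUnitaryGroup (Fin 2) ℂ)) =
      RLatticeK (((eta F n K : ℝ) : ℂ)⁻¹) (adBg F K 1) (adBgInv F K 1) (QDS F n K hnK.le c₀ cB 1) from rfl, hTl]
  -- both sides are `projR Δ^η_1 Q′` with the same range
  unfold RofUk
  rw [RLatticeK, RLatticeK, adBg_one_eq, adBgInv_one_eq, adTransportW_one_eq, adTransportW_inv_one_eq]
  have hcomp : ((fun _ : Bond 3 (periodsT3 F K) => (LinearMap.id : W₂ →ₗ[ℂ] W₂)) ∘ ⇑(bondCast hP.symm)) =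
      fun _ : Bond 3 (towerP F.L (fun _ : Fin 3 => (F.P K).sitesPerDir (K - n)) (K - n - 1 + 1)) => LinearMap.id := rfl
  rw [hcomp]
  exact congrArg (fun T : SiteL2K ℂ 3 _ c₀ W₂ →ₗ[ℂ] SiteL2K ℂ 3 _ c₀ W₂ => T (siteL2Cast ℂ hP l)) (projR_congr _ _ _ (map_ker_eq F n K hnK c₀ cB))

end Summit.QuantumFields.YangMills.Theorems.Prop7FlatGaugeProjectorTower

end
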